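import Summits.BirchSwinnertonDyer.BirchSwinnertonDyer.Theorems.AdditiveBranchIMCGordTwoTwistedWaldspurgerDisplayTwo
import HarnessLib

/-!
# Route `AdditiveBranchIMC`, crux `GordTwoRankZeroOffCaseOne` (19357), line `three_field_road`, DOOR D: the value at `𝟙` of EVERY ♭-frame over a
# DYADIC twisted road field (reading R4₂; LEAD g19; `--supports` 19357, helper only)

Theorems only. The `ℓ₀ = 2` sibling of `AdditiveBranchIMCGordTwoTwistedWaldspurgerFrame.lean` (LEAD g16, `intSeries_value_of_frame_manin_twisted`),
VERBATIM with the odd twisted configuration replaced by the dyadic one of R4₂ (`t ∈ {−1, 2, −2}`, `C • E^{(t)} = W₁`, `2 ∣ d_K`, `E^{(t)}`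
multiplicative at `2`, `E/K` non-split multiplicative above `2`, odd `ℓ ∣ N` split, `p ∤ 2 + 1`, `IsRationalCharacterFor νgal t`), over
`exists_continuousDisplay_manin_twisted_two`.
* `intSeries_value_of_frame_manin_twisted_two`.

References: [LiuZhangZhang2018] Thm 1.5.1, Remark 1.1.2, Thm 1.5.3, (1.2), (1.5), §1.4; [CaiShuTian2014] Prop 3.12 (last row); [Castella2018]
Thms. 3.1–3.2 (shapes); [EdixhovenManin1991] §1. presearch: n/a (kernel port over the typed reading R4₂). BSD is proved for no curve.
-/

set_option autoImplicit false
set_option linter.dupNamespace false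

noncomputable section

open scoped Classical MatrixGroups ModularForm Topology NumberField

namespace Summit.BirchSwinnertonDyer.BirchSwinnertonDyer.Theorems.TameWaldspurger

open Filter CongruenceSubgroup WeierstrassCurve NumberField IsDedekindDomain Field PowerSeries
  Literature.NumberTheory.EllipticCurves Literature.NumberTheory.EllipticCurves.ModularForms
  Literature.NumberTheory.EllipticCurves.LiuZhangZhang2018 Literature.NumberTheory.EllipticCurves.Rank1Residual
  Literature.NumberTheory.EllipticCurves.CaiShuTian2014
  Literature.NumberTheory.GaloisRepresentations
  Summit.BirchSwinnertonDyer.Rank1Residual Summit.BirchSwinnertonDyer.Rank1Residual.X11b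
  Summit.BirchSwinnertonDyer.Rank1Residual.X11b.Halves Summit.BirchSwinnertonDyer.Rank1Residual.X2
  Summit.BirchSwinnertonDyer.BirchSwinnertonDyer.Theorems.BiquadraticEisensteinDescentKatzWaldspurgerFrameCMInertBadFlatLZZRoad

section Twisted

variable {p : ℕ} [Fact p.Prime]

/-- **The value at `𝟙` of EVERY ♭-frame at an additive prime over a DYADIC twisted road field, Manin constant `c₁` kept** (verbatim the
sibling `intSeries_value_of_frame_manin_twisted` with the dyadic display): for the R4₂ data with the `ν`-weighted logarithm sum
`Σ_σ ν(σ) log_{ω_{W₁}}(y^σ) ≠ 0` (hypothesis `hLS`; the consumer gets it from the descent of `P_ν` to `E(K)` and rank one), `(κ, γ)` anticyclotomic,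
the embedding datum `ι′` inducing `𝔭` and `ι_K` inducing `𝔭` along `ι′`, ANY newform `f` of `W`: EVERY ♭-frame `(Ω_K′ ≠ 0, Ω_p′ ≠ 0, Q′)` with
`R1.IsBDPLFunctionInt p ι′ 𝔭 κ γ f Ω_K′ Ω_p′ Q′` has `Q′(𝟙) = u·(Σ_σ ν(σ) log_{ω_{W₁}}(y^σ) / c₁)²` with `‖u‖ = 1`. CONDITIONAL on `hF` (R4₂).
[cite: LiuZhangZhang2018, Thm 1.5.1 and Thm 1.5.3 (Duke Math. J. 167 pp. 748–749)] [cite: Castella2018, Thm. 3.1–3.2 (arXiv:1704.06608 pp. 8–9) (shapes)] -/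
theorem intSeries_value_of_frame_manin_twisted_two
    (hF : thm151_thm153_modularCurve_heegnerVector_additive_ramifiedTwistedAtTwo)
    (W : WeierstrassCurve ℚ) [W.IsElliptic] [W.IsGloballyMinimal]
    (W₁ : WeierstrassCurve ℚ) [W₁.IsElliptic] [W₁.IsGloballyMinimal]
    [(W₁.baseChange ℂ_[p]).IsIntegral (NormedField.valuation (K := ℂ_[p])).integer]
    (K : Type) [Field K] [NumberField K] (𝔭 : HeightOneSpectrum (𝓞 K))
    (κ : ZpExtension K p) (γ : absoluteGaloisGroup K) [Fact (κ.IsTopGenerator γ)] {N N₁ : ℕ} [NeZero N] [NeZero N₁]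
    (f : CuspForm (Gamma0 N) 2) (Dt₁ : ModularParametrizationData W₁ N₁)
    (ιK : K →+* ℂ) (β : ℤ) (y : (W₁.baseChange (ringClassField K ιK 1)).toAffine.Point)
    (ν : ringClassGal ιK 1 →* ℂˣ) (νgal : absoluteGaloisGroup K →ₜ* ℂˣ)
    (emb : ringClassField K ιK 1 →+* AlgebraicClosure K)
    (t : ℤ) (C : VariableChange ℚ)
    (hN : W.conductorNorm ℤ = N) (hN₁ : W₁.conductorNorm ℤ = N₁) (hp2N : p ^ 2 ∣ N)
    (hC : C • W.quadraticTwist (t : ℚ) = W₁)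
    (hp2 : p ≠ 2) (hK : IsImaginaryQuadratic K) (hd4 : NumberField.discr K < -4)
    (hsplit : ((Ideal.span {(p : ℤ)}).primesOver (𝓞 K)).ncard = 2)
    (h𝔭 : ((p : ℕ) : 𝓞 K) ∈ 𝔭.asIdeal)
    (ht : t = -1 ∨ t = 2 ∨ t = -2) (h2d : (2 : ℤ) ∣ NumberField.discr K)
    (hmult₂ : (W.quadraticTwist (t : ℚ)).HasMultiplicativeReductionAtPrime 2)
    (hbc : ∀ v : HeightOneSpectrum (𝓞 K), ((2 : ℕ) : 𝓞 K) ∈ v.asIdeal →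
      (W.baseChange K).HasMultiplicativeReductionAt v ∧ ¬ (W.baseChange K).HasSplitMultiplicativeReductionAt v)
    (hsplitq : ∀ ℓ : ℕ, ℓ.Prime → ℓ ∣ N → ℓ ≠ 2 → ((Ideal.span {(ℓ : ℤ)}).primesOver (𝓞 K)).ncard = 2)
    (hcut : ¬ p ∣ 2 + 1)
    (hκ : κ.IsAnticyclotomic) (hfW : IsNewformOf W f)
    (hemb : ∀ k : K, emb (algebraMap K (ringClassField K ιK 1) k) = algebraMap K (AlgebraicClosure K) k)
    (hinfl : IsInflationAlong ιK 1 emb ν νgal)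
    (hrat : Gross2004.IsRationalCharacterFor νgal t)
    (hβ : 4 * (N₁ : ℤ) ∣ β ^ 2 - NumberField.discr K)
    (hy : WeierstrassCurve.Affine.Point.map (ringClassField K ιK 1).subtype.toRatAlgHom y =
      heegnerPointComplexOfConductor Dt₁ (NumberField.discr K) β 1)
    (ι' : PadicAlgCl p ≃+* ℂ)
    (hι' : ∀ (w : InfinitePlace K) (k : 𝓞 K), k ∈ 𝔭.asIdeal ↔ ‖ι'.symm (w.embedding (k : K))‖ < 1)
    (hιK : ∀ k : 𝓞 K, k ∈ 𝔭.asIdeal ↔ ‖ι'.symm (ιK (k : K))‖ < 1)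
    (hLS : heegnerCharLogSum ι' ιK 1 W₁ ν y ≠ 0)
    {ΩK' : ℂ} {Ωp' : ℂ_[p]} {Q' : PowerSeries (PadicComplexInt p)} (hΩK' : ΩK' ≠ 0) (hΩp' : Ωp' ≠ 0)
    (hQ' : R1.IsBDPLFunctionInt p ι' 𝔭 κ γ f ΩK' Ωp' Q') :
    ∃ u : ℂ_[p], ‖u‖ = 1 ∧ IntSeries.HasValueAt Q' 0
      (u * (heegnerCharLogSum ι' ιK 1 W₁ ν y / (Dt₁.c : ℂ_[p])) ^ 2) := by
  have hγ : κ.IsTopGenerator γ := Fact.out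
  -- the continuous display (LZZ road over the dyadic twisted road field, Manin-robust) at the frame's `ι′`
  obtain ⟨Ωp₀, u, hΩp₀, hu, hcont⟩ :=
    exists_continuousDisplay_manin_twisted_two hF ι' W W₁ K 𝔭 κ γ f Dt₁ ιK β y ν νgal emb t C hN hN₁ hp2N hC hp2 hK hd4
      hsplit h𝔭 hι' hιK ht h2d hmult₂ hbc hsplitq hcut hκ hγ hfW hemb hinfl hrat hβ hy
  -- the limit is non-zero: `Σ ν(σ) log(y^σ) ≠ 0`, `c₁ ≠ 0`, `‖u‖ = 1`
  have hcZ : Dt₁.c ≠ 0 := Dt₁.maninConstant_ne_zero_holds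
  have hcQ : (Dt₁.c : ℂ_[p]) ≠ 0 := by exact_mod_cast hcZ
  have hu0 : u ≠ 0 := fun h0 ↦ by rw [h0, norm_zero] at hu; exact zero_ne_one hu
  have hc0 : u * (heegnerCharLogSum ι' ιK 1 W₁ ν y / (Dt₁.c : ℂ_[p])) ^ 2 ≠ 0 :=
    mul_ne_zero hu0 (pow_ne_zero _ (div_ne_zero hLS hcQ))
  have heq := intSeries_constantCoeff_eq_of_isBDPLFunctionInt_of_continuousValues hp2 hK hκ hγ one_ne_zero
    hΩK' hΩp₀ hΩp' hcont hc0 hQ'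
  refine ⟨u, hu, ?_⟩
  rw [← heq]
  exact R1.intSeries_hasValueAt_zero p Q'

end Twisted

end Summit.BirchSwinnertonDyer.BirchSwinnertonDyer.Theorems.TameWaldspurger

end
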